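import Mathlib
import Summits.ValiantsHypothesis.ValiantsHypothesis.Theorems.GrenetZeonTwoDimCoefficientsAfterCodimTwo
import Summits.ValiantsHypothesis.ValiantsHypothesis.Theorems.GrenetZeonTwoDimCoefficientsLinearForm
import Summits.ValiantsHypothesis.ValiantsHypothesis.Theorems.GrenetZeonTwoDimCoefficientsScalingRung

/-!
# Crux `GrenetZeon.TwoDimCoefficients` (stmt-ValiantsHypothesis-8062): `m ≥ 2n` for EVERY
# `(m, ≤ 2)`-representation of the permanent (unconditional; the crux's own currency)

The crux reads `∃ C n₀, ∀ n ≥ n₀, ∀ m, HasDim2Repr n m → n² ≤ C·m`.  Folding the tree's disjunctive form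
✓ `hasDim2Repr_sq_le_or_unipotent_all` (`n² ≤ C·m` unless the representation is unipotent-dual) with the
new scaling-closure rung ✓ `two_mul_le_of_dualUnipotentRepr` (`DualUnipotentRepr n m → 2n ≤ m`, `n ≥ 4`):

* ★ `hasDim2Repr_two_mul_le_all` — `∃ n₀, ∀ n ≥ n₀, ∀ m, HasDim2Repr n m → 2n ≤ m`.  Previous best valid for
  every `(m, ≤ 2)`-representation: `2n² ≤ (m + 2)²` (✓ `hasDim2Repr_two_mul_sq_le_all`, `m ≳ √2·n`).
* `twoDimCoefficients_hypothesis_two_mul_le` — the same bound for the verbatim hypothesis of the route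
  declaration `TwoDimCoefficients` (which is `HasDim2Repr` by `Iff.rfl`).

HONEST FRAMING: a LINEAR rung (constant `2`) where the crux asks for `n²/C`; the stub `DualUnipotentBound`,
the crux and `VP ≠ VNP` remain open.  No definitions, no named facts.

References: T. Mignon, N. Ressayre, Int. Math. Res. Not. 2004:79, Thm. 1.1 (via the tree).
-/

-- single-conjunct layout `Summits/ValiantsHypothesis/ValiantsHypothesis`: the duplicated namespace
-- component is mandated by the tree.
set_option linter.dupNamespace false
set_option autoImplicit false

noncomputable section

namespace Summit.ValiantsHypothesis.ValiantsHypothesis.Cruxes.TwoDimCoefficients.DimTwoCases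

open Summit.ValiantsHypothesis.ValiantsHypothesis.Theorems.GrenetZeonTwoDimCoefficients.ScalingClosure

/-- ★ **`m ≥ 2n` for every `(m, ≤ 2)`-representation of `per_n`, `n` large (unconditional).**  By
✓ `hasDim2Repr_sq_le_or_unipotent_all` either `n² ≤ C·m` — then `m ≥ 2n` once `n ≥ 2C` (and `n ≤ m`,
✓ `le_of_hasDim2Repr`) — or the representation is unipotent-dual and ✓ `two_mul_le_of_dualUnipotentRepr`
applies. [cite: MignonRessayre2004, Thm. 1.1 — via the tree; folklore fold] -/
theorem hasDim2Repr_two_mul_le_all :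
    ∃ n₀ : ℕ, ∀ n ≥ n₀, ∀ m : ℕ, HasDim2Repr n m → 2 * n ≤ m := by
  obtain ⟨C, n₀, hC⟩ := hasDim2Repr_sq_le_or_unipotent_all
  refine ⟨max n₀ (max 4 (2 * C)), fun n hn m h => ?_⟩
  have hn₀ : n₀ ≤ n := le_trans (le_max_left _ _) hn
  have hn4 : 4 ≤ n := le_trans (le_trans (le_max_left _ _) (le_max_right _ _)) hn
  have hnC : 2 * C ≤ n := le_trans (le_trans (le_max_right _ _) (le_max_right _ _)) hn
  rcases hC n hn₀ m h with h1 | h2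
  · have hnm : n ≤ m := le_of_hasDim2Repr h
    -- `n² ≤ C m` and `2C ≤ n` give `2n·n ≤ 2Cm ≤ n m`
    have p : 2 * C * m ≤ n * m := Nat.mul_le_mul_right m hnC
    by_contra hlt
    rw [not_le] at hlt
    have hpos : 0 < n := by omega
    nlinarith [h1, p, hlt, hpos]
  · exact two_mul_le_of_dualUnipotentRepr hn4 h2

/-- The same bound for the verbatim hypothesis of the route declaration `TwoDimCoefficients`
(`HasDim2Repr` is that hypothesis by `Iff.rfl`). [folklore] -/
theorem twoDimCoefficients_hypothesis_two_mul_le :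
    ∃ n₀ : ℕ, ∀ n ≥ n₀, ∀ m : ℕ,
      (∃ (R : Type) (_ : CommRing R) (_ : Algebra ℂ R) (_ : Module.Finite ℂ R),
        Module.finrank ℂ R ≤ 2 ∧
        ∃ (l : R →ₗ[ℂ] ℂ) (A : Matrix (Fin m) (Fin m) (MvPolynomial (Fin n × Fin n) R)),
          (∀ i j, (A i j).totalDegree ≤ 1) ∧
          ∀ d : (Fin n × Fin n) →₀ ℕ, l (MvPolynomial.coeff d A.det) =
            MvPolynomial.coeff d (Literature.Computability.AlgebraicComplexity.perPoly (Fin n) ℂ)) →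
      2 * n ≤ m :=
  hasDim2Repr_two_mul_le_all

end Summit.ValiantsHypothesis.ValiantsHypothesis.Cruxes.TwoDimCoefficients.DimTwoCases

end
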